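import Literature.Topology.FourManifolds.LatticeFormsStableOrthogonalGroupSublattice
import Literature.Topology.FourManifolds.LatticeFormsPolarisationTypesSplitNonsplit
import HarnessLib

/-!
# `Õ(L, h) ≅ Õ(h^⊥)` for every vector `h` with `(h, h) ≠ 0` of a nondegenerate lattice; the printed instance
# `Õ(L_{2t}, h_d) ≅ Õ((h_d)^⊥_{L_{2t}})` (Gritsenko–Hulek–Sankaran, *Compositio Math.* 146 (2010) Prop. 4.12 (i))

Trunk T-4MAN vocabulary; sequel of `LatticeFormsStableOrthogonalGroupSublattice.lean` (row g42-#1: for `B` symmetric on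
a finite free `ℤ`-module and any `S` with `B|_{S^⊥}` nondegenerate,
`{g ∈ O(S^⊥) | ḡ = id} = {G|_{S^⊥} | G ∈ O(L), Ḡ = id, G|_S = id}`, uniqueness of the extension, and Lemma 4.2 (ii)
`α` extends with `id_S` iff `ᾱ|_{p_{S^⊥}(H)} = id`), here read for `S = ℤh`: "`O(L, ℤh) = O(L, h)`", i.e. `G|_{ℤh} = id`
iff `G h = h`. The models are those of `LatticeFormsPolarisationTypesSplitNonsplit.lean` ∕ `LatticeFormsNegTwoVectorOrbits.lean`
(`B₀ ⊕ ⟨−2t⟩ = B₀.prod ((−2t) • mul)`, `(E₈(−1)^{⊕m} ⊕ U^{⊕k}) ⊕ ℤ(−2t)`; `L_{2t} = 3U ⊕ 2E₈(−1) ⊕ ⟨−2t⟩` is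
`m = 2`, `k = 3`). Written for lane `lit-hodgefound` (Track 2 foundations; prover seat `lit-hodgefound-p18`, gen 42,
row g42-#2). THEOREMS ONLY — no definition, no named fact, no instance, no notation.

## Source, verbatim (V. Gritsenko, K. Hulek, G. K. Sankaran, Compositio Math. 146 (2010) 404–434, arXiv numbering §4,
held text `paper:arxiv-0802.2078` pp. 10, 12)

"`O(L,S) = {g ∈ O(L) | g|_S ∈ Õ(S)}` and `Õ(L,S) = O(L,S) ∩ Õ(L)`. Note that `O(L, ℤh) = O(L, h)` if `h² ≠ ±2`. […]
We consider the special lattice `L_{2t} = 3U ⊕ 2E₈(−1) ⊕ ⟨−2t⟩` […] we denote by `h_d` a primitive vector of length `2d`.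
[…] **Proposition 4.12.** Let `h_d ∈ L_{2t}` be a primitive vector such that `h_d² = 2d` and `div(h_d) = f`. Assume
that `w = 1`, i.e. `f` and `(2t/f, 2d/f)` are coprime. Then (i) `Õ(L_{2t}, h_d) ≅ Õ((h_d)^⊥_{L_{2t}})`. […] *Proof.*
[…] According to Lemma 4.2, `O(L_{2t}, h_d) ≅ {γ ∈ O(h_d^⊥) | γ̄|_{p(H)} = id}`. Let us consider an element
`γ ∈ O(h_d^⊥)` satisfying `γ̄|_{p(H)} = id` as an element of `O(L_{2t}, h_d)` (i.e., we put `γ(h_d) = h_d`). According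
to the decomposition above `γ ∈ Õ(L_{2t}, h_d)` if and only if `γ̄(k̄₃) = k̄₃`. Therefore `Õ(L_{2t}, h_d) ≅ Õ(h_d^⊥)`."

## Contents (all proved) and reading notes

* §1 Any nondegenerate symmetric `L = (M, B)`, `h ∈ L` with `(h, h) ≠ 0` (neither primitivity of `h` nor `w = 1` nor
  evenness is used — see the reading notes of the predecessor file; the printed hypotheses only enter GHS's own proof):
  `h^⊥` is nondegenerate (`nondegenerate_restrict_orthogonal_span_singleton`); **(i)** as the set equality
  `{g ∈ O(h^⊥) | ḡ = id} = {G|_{h^⊥} | G ∈ O(L), Ḡ = id, G h = h}`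
  (`setOf_discriminantGroupCongr_eq_id_eq_setOf_exists_stable_apply_eq`) with its two directions
  (`exists_stable_isometryEquiv_apply_eq_of_discriminantGroupCongr_eq_id`,
  `exists_restrict_discriminantGroupCongr_eq_id_of_apply_eq_of_discriminantGroupCongr_eq_id`) and the injectivity of
  `G ↦ G|_{h^⊥}` on `O(L, h)` (`isometryEquiv_apply_eq_of_apply_eq_of_forall_coe_apply_eq`), so that restriction is a
  bijection `Õ(L, h) → Õ(h^⊥)`; and the first display of the proof, **`O(L, h)|_{h^⊥} = {γ ∈ O(h^⊥) | γ̄|_{p(H)} = id}`**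
  (`setOf_discriminantGroupCongr_toDiscriminantGroup_eq_eq_setOf_exists_apply_eq`), `p(H)` = range of
  `B.toDiscriminantGroup h^⊥`.
* §2 **Prop. 4.12 (i) verbatim for `L = B₀ ⊕ ⟨−2t⟩`**, `B₀` symmetric unimodular, `t ≥ 1`, `h² = 2d`, `d ≠ 0`
  (`setOf_discriminantGroupCongr_eq_id_eq_of_prod_neg_twoMul`), and §3 for the coordinate models
  `(E₈(−1)^{⊕m} ⊕ U^{⊕k}) ⊕ ℤ(−2t)` (`setOf_discriminantGroupCongr_eq_id_eq_of_model`; `L_{2t}`: `m = 2`, `k = 3`).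
* GROUPS: no `Õ⁺` in the tree (no spinor norm); `Õ(L) = {g | ḡ = id}`, `O(L, h) = {g | g h = h}`; "`≅`" = equality of
  subsets of `O(h^⊥)` + injectivity of restriction, as in the sibling files. Prop. 4.12 (ii) is not in this file.

## References

* [GritsenkoHulekSankaran2010Symplectic] V. Gritsenko, K. Hulek, G. K. Sankaran, Moduli spaces of irreducible symplectic
  manifolds, Compositio Math. 146 (2010) 404–434 (arXiv:0802.2078): §4 Lemma 4.2, Prop. 4.12 (i) and its proof.
* [GritsenkoHulekSankaran2013ModuliK3] V. Gritsenko, K. Hulek, G. K. Sankaran, Moduli of K3 surfaces and irreducible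
  symplectic manifolds, Handbook of Moduli I (2013): §7 Lemma 7.1, Lemma 7.3, eq. (25) `O(L, ℤh) = O(L, h)`.
-/

noncomputable section

open Module Function
open LinearMap (BilinForm)
open Literature.Topology.FourManifolds

namespace LinearMap.BilinForm

/-! ### §1 `Õ(L, h) ≅ Õ(h^⊥)` for any `h` with `(h, h) ≠ 0` in a nondegenerate lattice -/

section General

variable {M : Type*} [AddCommGroup M] (B : BilinForm ℤ M)

/-- `G|_{ℤh} = id ⟺ G h = h` ("`O(L, ℤh) = O(L, h)`" for the pointwise stabiliser).
[cite: GritsenkoHulekSankaran2010Symplectic, §4 ("Note that `O(L, ℤh) = O(L, h)`")] -/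
theorem forall_mem_span_singleton_apply_eq_iff (G : B.IsometryEquiv B) (h : M) :
    (∀ s ∈ ℤ ∙ h, G s = s) ↔ G h = h :=
  ⟨fun H ↦ H h (Submodule.mem_span_singleton_self h), fun H s hs ↦ by
    obtain ⟨c, rfl⟩ := Submodule.mem_span_singleton.1 hs
    rw [map_zsmul, H]⟩

variable [Module.Finite ℤ M] [Module.Free ℤ M]

/-- **`h^⊥` is a (nondegenerate) lattice** for `(h, h) ≠ 0` in a nondegenerate symmetric `L` (`ℤh ≅ ⟨(h,h)⟩` is
nondegenerate and `ℤh ⊕ h^⊥` has finite index). [cite: GritsenkoHulekSankaran2010Symplectic, §4 ("`S = L_{h^⊥}` for some `h ∈ L` with `h² ≠ 0`"; "By lattice … we always mean a non-degenerate lattice")] -/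
theorem nondegenerate_restrict_orthogonal_span_singleton (hBn : B.Nondegenerate) (hB : B.IsSymm) {h : M}
    (hh : B h h ≠ 0) : (B.restrict (B.orthogonal (ℤ ∙ h))).Nondegenerate :=
  B.nondegenerate_restrict_orthogonal_of_nondegenerate_restrict hBn hB _ (B.nondegenerate_restrict_span_singleton hh)

/-- **Prop. 4.12 (i) for every lattice: `Õ(h^⊥) = {G|_{h^⊥} | G ∈ Õ(L), G h = h}`.** For `B` nondegenerate symmetric on
a finitely generated free `ℤ`-module and `(h, h) ≠ 0`, the isometries of `h^⊥` acting trivially on `D(h^⊥)` are exactly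
the restrictions of the isometries of `L` acting trivially on `D(L)` and fixing `h` (printed for `L = L_{2t}`,
`h = h_d` primitive with `w = 1`; none of these is used). [cite: GritsenkoHulekSankaran2010Symplectic, §4 Prop. 4.12 (i)] [cite: GritsenkoHulekSankaran2013ModuliK3, §7 Lemma 7.1] -/
theorem setOf_discriminantGroupCongr_eq_id_eq_setOf_exists_stable_apply_eq (hBn : B.Nondegenerate) (hB : B.IsSymm)
    {h : M} (hh : B h h ≠ 0) :
    {g : (B.restrict (B.orthogonal (ℤ ∙ h))).IsometryEquiv (B.restrict (B.orthogonal (ℤ ∙ h))) |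
        ∀ a, g.discriminantGroupCongr a = a} =
      {g | ∃ G : B.IsometryEquiv B, (∀ a, G.discriminantGroupCongr a = a) ∧ G h = h ∧
        ∀ n : B.orthogonal (ℤ ∙ h), G n = g n} := by
  rw [B.setOf_discriminantGroupCongr_eq_id_eq_setOf_exists_stable hB (ℤ ∙ h)
    (B.nondegenerate_restrict_orthogonal_span_singleton hBn hB hh)]
  ext g
  simp only [Set.mem_setOf_eq, forall_mem_span_singleton_apply_eq_iff]

/-- **Prop. 4.12 (i), `Õ(h^⊥) → Õ(L, h)`**: every `g ∈ Õ(h^⊥)` is `G|_{h^⊥}` for some `G ∈ Õ(L)` with `G h = h`.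
[cite: GritsenkoHulekSankaran2010Symplectic, §4 Prop. 4.12 (i) (proof: "we put `γ(h_d) = h_d`")] [cite: GritsenkoHulekSankaran2013ModuliK3, §7 Lemma 7.1] -/
theorem exists_stable_isometryEquiv_apply_eq_of_discriminantGroupCongr_eq_id (hBn : B.Nondegenerate) (hB : B.IsSymm)
    {h : M} (hh : B h h ≠ 0) (g : (B.restrict (B.orthogonal (ℤ ∙ h))).IsometryEquiv (B.restrict (B.orthogonal (ℤ ∙ h))))
    (hg : ∀ a, g.discriminantGroupCongr a = a) :
    ∃ G : B.IsometryEquiv B, (∀ a, G.discriminantGroupCongr a = a) ∧ G h = h ∧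
      ∀ n : B.orthogonal (ℤ ∙ h), G n = g n :=
  (Set.ext_iff.1 (B.setOf_discriminantGroupCongr_eq_id_eq_setOf_exists_stable_apply_eq hBn hB hh) g).1 hg

omit [Module.Free ℤ M] in
/-- **Prop. 4.12 (i), `Õ(L, h) → Õ(h^⊥)`**: every `G ∈ Õ(L)` with `G h = h` restricts to `h^⊥`, and the restriction
acts trivially on `D(h^⊥)` (no nondegeneracy needed). [cite: GritsenkoHulekSankaran2010Symplectic, §4 Prop. 4.12 (i)] -/
theorem exists_restrict_discriminantGroupCongr_eq_id_of_apply_eq_of_discriminantGroupCongr_eq_id (hB : B.IsSymm)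
    {h : M} (G : B.IsometryEquiv B) (hGh : G h = h) (hGbar : ∀ a, G.discriminantGroupCongr a = a) :
    ∃ g : (B.restrict (B.orthogonal (ℤ ∙ h))).IsometryEquiv (B.restrict (B.orthogonal (ℤ ∙ h))),
      (∀ n : B.orthogonal (ℤ ∙ h), (g n : M) = G n) ∧ ∀ a, g.discriminantGroupCongr a = a :=
  B.exists_restrict_discriminantGroupCongr_eq_id_of_forall_apply_eq hB (ℤ ∙ h) G
    ((B.forall_mem_span_singleton_apply_eq_iff G h).2 hGh) hGbar

/-- **Restriction `O(L, h) → O(h^⊥)` is injective**: isometries with the same value at `h` (`(h,h) ≠ 0`) and the same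
restriction to `h^⊥` coincide (`ℤh ⊕ h^⊥` has finite index) — so Prop. 4.12 (i) is a bijection `Õ(L, h) ≅ Õ(h^⊥)`.
[cite: GritsenkoHulekSankaran2010Symplectic, §4 Prop. 4.12 (i)] -/
theorem isometryEquiv_apply_eq_of_apply_eq_of_forall_coe_apply_eq (hB : B.IsSymm) {h : M} (hh : B h h ≠ 0)
    (G G' : B.IsometryEquiv B) (h₁ : G h = G' h) (h₂ : ∀ n : B.orthogonal (ℤ ∙ h), G n = G' n) (x : M) :
    G x = G' x :=
  B.isometryEquiv_apply_eq_of_eqOn_of_eqOn_orthogonal (ℤ ∙ h) hB (B.nondegenerate_restrict_span_singleton hh) G G'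
    (fun s hs ↦ by
      obtain ⟨c, rfl⟩ := Submodule.mem_span_singleton.1 hs
      rw [map_zsmul, map_zsmul, h₁])
    (fun n hn ↦ h₂ ⟨n, hn⟩) x

/-- **`O(L, h)|_{h^⊥} = {γ ∈ O(h^⊥) | γ̄|_{p(H)} = id}`** (the first display in the proof of Prop. 4.12, from Lemma 4.2):
for `B` nondegenerate symmetric and `(h,h) ≠ 0`, an isometry `γ` of `h^⊥` is the restriction of an isometry of `L`
fixing `h` iff `γ̄` fixes every class `[(x, ·)|_{h^⊥}]`, `x ∈ L` (the range of `B.toDiscriminantGroup h^⊥`).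
[cite: GritsenkoHulekSankaran2010Symplectic, §4 Lemma 4.2 (ii) and proof of Prop. 4.12 ("`O(L_{2t}, h_d) ≅ {γ ∈ O(h_d^⊥) | γ̄|_{p(H)} = id}`")] -/
theorem setOf_discriminantGroupCongr_toDiscriminantGroup_eq_eq_setOf_exists_apply_eq (hBn : B.Nondegenerate)
    (hB : B.IsSymm) {h : M} (hh : B h h ≠ 0) :
    {γ : (B.restrict (B.orthogonal (ℤ ∙ h))).IsometryEquiv (B.restrict (B.orthogonal (ℤ ∙ h))) |
        ∀ x : M, γ.discriminantGroupCongr (B.toDiscriminantGroup (B.orthogonal (ℤ ∙ h)) x) =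
          B.toDiscriminantGroup (B.orthogonal (ℤ ∙ h)) x} =
      {γ | ∃ G : B.IsometryEquiv B, G h = h ∧ ∀ n : B.orthogonal (ℤ ∙ h), G n = γ n} := by
  ext γ
  simp only [Set.mem_setOf_eq]
  rw [← B.exists_isometryEquiv_eq_id_extends_iff hB (ℤ ∙ h) (B.nondegenerate_restrict_orthogonal_span_singleton hBn hB hh)]
  simp only [forall_mem_span_singleton_apply_eq_iff]

end General

end LinearMap.BilinForm

namespace Literature.Topology.FourManifolds

open LinearMap.BilinForm

/-! ### §2 Prop. 4.12 (i) for `L = B₀ ⊕ ⟨−2t⟩`, `B₀` unimodular -/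

section Abstract

variable {M : Type*} [AddCommGroup M] [Module.Finite ℤ M] [Module.Free ℤ M] (B₀ : BilinForm ℤ M) (t : ℕ)

/-- **Prop. 4.12 (i) for `L = B₀ ⊕ ⟨−2t⟩`** (`B₀` symmetric unimodular — e.g. `3U ⊕ 2E₈(−1)`, giving `L_{2t}` —,
`t ≥ 1`): for `h ∈ L` with `h² = 2d`, `d ≠ 0`, **`Õ(h^⊥) = {G|_{h^⊥} | G ∈ Õ(L), G h = h} ≅ Õ(L, h)`** (restriction
being injective by `isometryEquiv_apply_eq_of_apply_eq_of_forall_coe_apply_eq`). Printed for primitive `h_d` with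
`w = 1`; neither hypothesis is needed. [cite: GritsenkoHulekSankaran2010Symplectic, §4 Prop. 4.12 (i)] -/
theorem setOf_discriminantGroupCongr_eq_id_eq_of_prod_neg_twoMul (hs : B₀.IsSymm) (hu : B₀.IsUnimodular)
    (ht : 0 < t) {h : M × ℤ} {d : ℤ} (hd : d ≠ 0) (hh : B₀.prod ((-(2 * t : ℤ)) • LinearMap.mul ℤ ℤ) h h = 2 * d) :
    {g : ((B₀.prod ((-(2 * t : ℤ)) • LinearMap.mul ℤ ℤ)).restrict
          ((B₀.prod ((-(2 * t : ℤ)) • LinearMap.mul ℤ ℤ)).orthogonal (ℤ ∙ h))).IsometryEquiv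
        ((B₀.prod ((-(2 * t : ℤ)) • LinearMap.mul ℤ ℤ)).restrict
          ((B₀.prod ((-(2 * t : ℤ)) • LinearMap.mul ℤ ℤ)).orthogonal (ℤ ∙ h))) |
        ∀ a, g.discriminantGroupCongr a = a} =
      {g | ∃ G : (B₀.prod ((-(2 * t : ℤ)) • LinearMap.mul ℤ ℤ)).IsometryEquiv
          (B₀.prod ((-(2 * t : ℤ)) • LinearMap.mul ℤ ℤ)),
        (∀ a, G.discriminantGroupCongr a = a) ∧ G h = h ∧
          ∀ n : (B₀.prod ((-(2 * t : ℤ)) • LinearMap.mul ℤ ℤ)).orthogonal (ℤ ∙ h), G n = g n} :=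
  (B₀.prod ((-(2 * t : ℤ)) • LinearMap.mul ℤ ℤ)).setOf_discriminantGroupCongr_eq_id_eq_setOf_exists_stable_apply_eq
    (nondegenerate_prod_neg_twoMul_smul_mul B₀ t hu ht) (hs.prod (isSymm_smul_mul _)) (by rw [hh]; omega)

/-- **`O(L, h)|_{h^⊥} = {γ ∈ O(h^⊥) | γ̄|_{p(H)} = id}` for `L = B₀ ⊕ ⟨−2t⟩`** (`B₀` symmetric unimodular, `t ≥ 1`,
`h² = 2d ≠ 0`). [cite: GritsenkoHulekSankaran2010Symplectic, §4 Lemma 4.2 and proof of Prop. 4.12 ("`O(L_{2t}, h_d) ≅ {γ ∈ O(h_d^⊥) | γ̄|_{p(H)} = id}`")] -/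
theorem setOf_discriminantGroupCongr_toDiscriminantGroup_eq_eq_of_prod_neg_twoMul (hs : B₀.IsSymm)
    (hu : B₀.IsUnimodular) (ht : 0 < t) {h : M × ℤ} {d : ℤ} (hd : d ≠ 0)
    (hh : B₀.prod ((-(2 * t : ℤ)) • LinearMap.mul ℤ ℤ) h h = 2 * d) :
    {γ : ((B₀.prod ((-(2 * t : ℤ)) • LinearMap.mul ℤ ℤ)).restrict
          ((B₀.prod ((-(2 * t : ℤ)) • LinearMap.mul ℤ ℤ)).orthogonal (ℤ ∙ h))).IsometryEquiv
        ((B₀.prod ((-(2 * t : ℤ)) • LinearMap.mul ℤ ℤ)).restrict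
          ((B₀.prod ((-(2 * t : ℤ)) • LinearMap.mul ℤ ℤ)).orthogonal (ℤ ∙ h))) |
        ∀ x, γ.discriminantGroupCongr
            ((B₀.prod ((-(2 * t : ℤ)) • LinearMap.mul ℤ ℤ)).toDiscriminantGroup
              ((B₀.prod ((-(2 * t : ℤ)) • LinearMap.mul ℤ ℤ)).orthogonal (ℤ ∙ h)) x) =
          (B₀.prod ((-(2 * t : ℤ)) • LinearMap.mul ℤ ℤ)).toDiscriminantGroup
            ((B₀.prod ((-(2 * t : ℤ)) • LinearMap.mul ℤ ℤ)).orthogonal (ℤ ∙ h)) x} =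
      {γ | ∃ G : (B₀.prod ((-(2 * t : ℤ)) • LinearMap.mul ℤ ℤ)).IsometryEquiv
          (B₀.prod ((-(2 * t : ℤ)) • LinearMap.mul ℤ ℤ)),
        G h = h ∧ ∀ n : (B₀.prod ((-(2 * t : ℤ)) • LinearMap.mul ℤ ℤ)).orthogonal (ℤ ∙ h), G n = γ n} :=
  (B₀.prod ((-(2 * t : ℤ)) • LinearMap.mul ℤ ℤ)).setOf_discriminantGroupCongr_toDiscriminantGroup_eq_eq_setOf_exists_apply_eq
    (nondegenerate_prod_neg_twoMul_smul_mul B₀ t hu ht) (hs.prod (isSymm_smul_mul _)) (by rw [hh]; omega)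

end Abstract

/-! ### §3 The models `(E₈(−1)^{⊕m} ⊕ U^{⊕k}) ⊕ ℤ(−2t)` (`L_{2t} = 3U ⊕ 2E₈(−1) ⊕ ⟨−2t⟩`: `m = 2`, `k = 3`) -/

section Model

variable (m k t : ℕ)

/-- **Prop. 4.12 (i) verbatim for `L_{2t}` and its relatives `(E₈(−1)^{⊕m} ⊕ U^{⊕k}) ⊕ ℤ(−2t)`** (`t ≥ 1`; `h² = 2d`,
`d ≠ 0`): `Õ(h^⊥) = {G|_{h^⊥} | G ∈ Õ(L), G h = h} ≅ Õ(L, h)`. [cite: GritsenkoHulekSankaran2010Symplectic, §4 Prop. 4.12 (i) ("`Õ(L_{2t}, h_d) ≅ Õ((h_d)^⊥_{L_{2t}})`")] -/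
theorem setOf_discriminantGroupCongr_eq_id_eq_of_model (ht : 0 < t)
    {h : ((Fin m → Fin 8 → ℤ) × ((Fin k → ℤ) × (Fin k → ℤ))) × ℤ} {d : ℤ} (hd : d ≠ 0)
    (hh : (((LinearMap.BilinForm.pi fun _ : Fin m ↦ -e8Form).prod (hyperbolicSum k)).prod
      ((-(2 * t : ℤ)) • LinearMap.mul ℤ ℤ)) h h = 2 * d) :
    {g : ((((LinearMap.BilinForm.pi fun _ : Fin m ↦ -e8Form).prod (hyperbolicSum k)).prod
            ((-(2 * t : ℤ)) • LinearMap.mul ℤ ℤ)).restrict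
          ((((LinearMap.BilinForm.pi fun _ : Fin m ↦ -e8Form).prod (hyperbolicSum k)).prod
            ((-(2 * t : ℤ)) • LinearMap.mul ℤ ℤ)).orthogonal (ℤ ∙ h))).IsometryEquiv
        ((((LinearMap.BilinForm.pi fun _ : Fin m ↦ -e8Form).prod (hyperbolicSum k)).prod
            ((-(2 * t : ℤ)) • LinearMap.mul ℤ ℤ)).restrict
          ((((LinearMap.BilinForm.pi fun _ : Fin m ↦ -e8Form).prod (hyperbolicSum k)).prod
            ((-(2 * t : ℤ)) • LinearMap.mul ℤ ℤ)).orthogonal (ℤ ∙ h))) |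
        ∀ a, g.discriminantGroupCongr a = a} =
      {g | ∃ G : (((LinearMap.BilinForm.pi fun _ : Fin m ↦ -e8Form).prod (hyperbolicSum k)).prod
            ((-(2 * t : ℤ)) • LinearMap.mul ℤ ℤ)).IsometryEquiv
          (((LinearMap.BilinForm.pi fun _ : Fin m ↦ -e8Form).prod (hyperbolicSum k)).prod
            ((-(2 * t : ℤ)) • LinearMap.mul ℤ ℤ)),
        (∀ a, G.discriminantGroupCongr a = a) ∧ G h = h ∧
          ∀ n : (((LinearMap.BilinForm.pi fun _ : Fin m ↦ -e8Form).prod (hyperbolicSum k)).prod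
            ((-(2 * t : ℤ)) • LinearMap.mul ℤ ℤ)).orthogonal (ℤ ∙ h), G n = g n} := by
  obtain ⟨hsB, -, huB⟩ := isSymm_isEven_isUnimodular_pi_neg_e8Form_prod_hyperbolicSum' m k
  exact setOf_discriminantGroupCongr_eq_id_eq_of_prod_neg_twoMul _ t hsB huB ht hd hh

/-- **`O(L, h)|_{h^⊥} = {γ ∈ O(h^⊥) | γ̄|_{p(H)} = id}` for the models `(E₈(−1)^{⊕m} ⊕ U^{⊕k}) ⊕ ℤ(−2t)`** (`t ≥ 1`,
`h² = 2d ≠ 0`). [cite: GritsenkoHulekSankaran2010Symplectic, §4 Lemma 4.2 and proof of Prop. 4.12] -/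
theorem setOf_discriminantGroupCongr_toDiscriminantGroup_eq_eq_of_model (ht : 0 < t)
    {h : ((Fin m → Fin 8 → ℤ) × ((Fin k → ℤ) × (Fin k → ℤ))) × ℤ} {d : ℤ} (hd : d ≠ 0)
    (hh : (((LinearMap.BilinForm.pi fun _ : Fin m ↦ -e8Form).prod (hyperbolicSum k)).prod
      ((-(2 * t : ℤ)) • LinearMap.mul ℤ ℤ)) h h = 2 * d) :
    {γ : ((((LinearMap.BilinForm.pi fun _ : Fin m ↦ -e8Form).prod (hyperbolicSum k)).prod
            ((-(2 * t : ℤ)) • LinearMap.mul ℤ ℤ)).restrict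
          ((((LinearMap.BilinForm.pi fun _ : Fin m ↦ -e8Form).prod (hyperbolicSum k)).prod
            ((-(2 * t : ℤ)) • LinearMap.mul ℤ ℤ)).orthogonal (ℤ ∙ h))).IsometryEquiv
        ((((LinearMap.BilinForm.pi fun _ : Fin m ↦ -e8Form).prod (hyperbolicSum k)).prod
            ((-(2 * t : ℤ)) • LinearMap.mul ℤ ℤ)).restrict
          ((((LinearMap.BilinForm.pi fun _ : Fin m ↦ -e8Form).prod (hyperbolicSum k)).prod
            ((-(2 * t : ℤ)) • LinearMap.mul ℤ ℤ)).orthogonal (ℤ ∙ h))) |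
        ∀ x, γ.discriminantGroupCongr
            ((((LinearMap.BilinForm.pi fun _ : Fin m ↦ -e8Form).prod (hyperbolicSum k)).prod
              ((-(2 * t : ℤ)) • LinearMap.mul ℤ ℤ)).toDiscriminantGroup
              ((((LinearMap.BilinForm.pi fun _ : Fin m ↦ -e8Form).prod (hyperbolicSum k)).prod
                ((-(2 * t : ℤ)) • LinearMap.mul ℤ ℤ)).orthogonal (ℤ ∙ h)) x) =
          (((LinearMap.BilinForm.pi fun _ : Fin m ↦ -e8Form).prod (hyperbolicSum k)).prod
              ((-(2 * t : ℤ)) • LinearMap.mul ℤ ℤ)).toDiscriminantGroup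
            ((((LinearMap.BilinForm.pi fun _ : Fin m ↦ -e8Form).prod (hyperbolicSum k)).prod
              ((-(2 * t : ℤ)) • LinearMap.mul ℤ ℤ)).orthogonal (ℤ ∙ h)) x} =
      {γ | ∃ G : (((LinearMap.BilinForm.pi fun _ : Fin m ↦ -e8Form).prod (hyperbolicSum k)).prod
            ((-(2 * t : ℤ)) • LinearMap.mul ℤ ℤ)).IsometryEquiv
          (((LinearMap.BilinForm.pi fun _ : Fin m ↦ -e8Form).prod (hyperbolicSum k)).prod
            ((-(2 * t : ℤ)) • LinearMap.mul ℤ ℤ)),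
        G h = h ∧ ∀ n : (((LinearMap.BilinForm.pi fun _ : Fin m ↦ -e8Form).prod (hyperbolicSum k)).prod
            ((-(2 * t : ℤ)) • LinearMap.mul ℤ ℤ)).orthogonal (ℤ ∙ h), G n = γ n} := by
  obtain ⟨hsB, -, huB⟩ := isSymm_isEven_isUnimodular_pi_neg_e8Form_prod_hyperbolicSum' m k
  exact setOf_discriminantGroupCongr_toDiscriminantGroup_eq_eq_of_prod_neg_twoMul _ t hsB huB ht hd hh

end Model

end Literature.Topology.FourManifolds
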